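import Summits.HodgeConjecture.HodgeConjecture.Theorems.HodgeLocusCensusPlaneSumCert
import HarnessLib

/-!
# HodgeLocusCensusPlaneSumRank8 — a valid core certificate decides the rank of Movasati's matrix of a signed plane sum on the Fermat quartic EIGHTFOLD (cell pub-hlocus, LEAD gen 5, (T36))
HONEST FRAMING: certified instances and evidence bearing on the general Hodge conjecture; no claim.

MAIN THEOREM `ivhsRankEq_of_cert8`: the n = 8 companion of `HodgeLocusCensusPlaneSumRank4.ivhsRankEq_of_cert4` — SAME certificate Ψ (the core
depends on the three head coordinates only), modes now enumerated over the 45 types of `HodgeLocusCensusPlaneRank8` (type k has shape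
(σ₀, σ₁, σ₂) and tail pair sums σ₃, σ₄; r = Σ_k r_{shape k}); the factors carry the tail characters ζ^{i₆+i₈} and ζ^{(j₆+1)+(j₈+1)}; rows of I₆ with a
pair sum > 2 (no type) are identically zero on both sides (`HodgeLocusCensusPlaneRank8.sig_cover'`, `row_sum`). Pivot rows (h ; σ − h ; 0, σ₃, 0, σ₄),
pivot columns (g ; 2 − σ − g ; 0, 2 − σ₃, 0, 2 − σ₄).
-/

namespace Summit.HodgeConjecture.HodgeConjecture.HodgeLocus.Census.PlaneSum

open TwistCells PlaneRank8

section cert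

variable {K : Type*} [Field K] (ζ : K) (L : List (ℤ × ℕ × ℕ × ℕ)) (Ψ : CoreCert) {r : ℕ} (modeK : Fin r → Fin 45) (off : Fin 45 → ℕ)

/-- left factor: U[i, m] = [type(i) = type(m)] · ζ^{i₆+i₈} · A_{σ}[head(i), ℓ(m)](ζ). -/
noncomputable def U8 : Matrix (indexSet 8 4 (8 / 2 * 4 - 8 - 2)) (Fin r) K := fun i m =>
  if i.1 0 + i.1 1 = sig0 (modeK m) ∧ i.1 2 + i.1 3 = sig1 (modeK m) ∧ i.1 4 + i.1 5 = sig2 (modeK m) ∧ i.1 6 + i.1 7 = sig3 (modeK m) ∧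
      i.1 8 + i.1 9 = sig4 (modeK m) then
    ζ ^ (i.1 6 + i.1 8) * Z8.eval ζ (Ψ.A (sig0 (modeK m)) (sig1 (modeK m)) (sig2 (modeK m)) (i.1 0) (i.1 2) (i.1 4) (m.1 - off (modeK m))) else 0

/-- right factor: V[m, j] = [type(j) complementary to type(m)] · ζ^{(j₆+1)+(j₈+1)} · B_{σ}[ℓ(m), head(j)](ζ). -/
noncomputable def V8 : Matrix (Fin r) (indexSet 8 4 4) K := fun m j =>
  if sig0 (modeK m) + (j.1 0 + j.1 1) = 2 ∧ sig1 (modeK m) + (j.1 2 + j.1 3) = 2 ∧ sig2 (modeK m) + (j.1 4 + j.1 5) = 2 ∧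
      sig3 (modeK m) + (j.1 6 + j.1 7) = 2 ∧ sig4 (modeK m) + (j.1 8 + j.1 9) = 2 then
    ζ ^ (j.1 6 + 1 + (j.1 8 + 1)) * Z8.eval ζ (Ψ.B (sig0 (modeK m)) (sig1 (modeK m)) (sig2 (modeK m)) (m.1 - off (modeK m)) (j.1 0) (j.1 2) (j.1 4)) else 0

/-- ENTRY FORMULA of M_δ for δ = planeList8 L. -/
theorem ivhsMatrix_planeList8_apply (h4 : ζ ^ 4 = -1) (i : indexSet 8 4 (8 / 2 * 4 - 8 - 2)) (j : indexSet 8 4 4) :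
    ivhsMatrix 8 4 ζ (planeList8 L) i j =
      if i.1 0 + j.1 0 + (i.1 1 + j.1 1) = 2 ∧ i.1 2 + j.1 2 + (i.1 3 + j.1 3) = 2 ∧ i.1 4 + j.1 4 + (i.1 5 + j.1 5) = 2 ∧
          i.1 6 + j.1 6 + (i.1 7 + j.1 7) = 2 ∧ i.1 8 + j.1 8 + (i.1 9 + j.1 9) = 2 then
        ζ ^ (i.1 6 + j.1 6 + 1 + (i.1 8 + j.1 8 + 1)) * Z8.eval ζ (core L (i.1 0 + j.1 0) (i.1 2 + j.1 2) (i.1 4 + j.1 4)) else 0 := by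
  unfold ivhsMatrix
  rw [periodComb_planeList8 ζ h4]

/-- STRUCTURE THEOREM: M_δ = U · V through K^r. -/
theorem ivhsMatrix_planeList8_eq_mul (h4 : ζ ^ 4 = -1) (hV : Ψ.valid L = true)
    (H1 : ∀ m : Fin r, off (modeK m) ≤ m.1 ∧ m.1 < off (modeK m) + rs8 Ψ (modeK m)) (H2 : ∀ k : Fin 45, off k + rs8 Ψ k ≤ r)
    (H3 : ∀ m : Fin r, ∀ k : Fin 45, off k ≤ m.1 → m.1 < off k + rs8 Ψ k → modeK m = k) :
    ivhsMatrix 8 4 ζ (planeList8 L) = U8 ζ Ψ modeK off * V8 ζ Ψ modeK off := by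
  ext i j
  rw [Matrix.mul_apply, ivhsMatrix_planeList8_apply ζ L h4]
  by_cases hex : ∃ k : Fin 45, i.1 0 + i.1 1 = sig0 k ∧ i.1 2 + i.1 3 = sig1 k ∧ i.1 4 + i.1 5 = sig2 k ∧ i.1 6 + i.1 7 = sig3 k ∧
      i.1 8 + i.1 9 = sig4 k
  · obtain ⟨k₀, h0, h1, h2, h3, h5⟩ := hex
    obtain ⟨l0, l1, l2, l3, l4⟩ := sig_le k₀
    have hU : ∀ m : Fin r, modeK m ≠ k₀ → U8 ζ Ψ modeK off i m = 0 := by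
      intro m hm
      unfold U8
      rw [if_neg]
      intro h
      exact hm (sig_inj _ _ (h.1.symm.trans h0) (h.2.1.symm.trans h1) (h.2.2.1.symm.trans h2) (h.2.2.2.1.symm.trans h3)
        (h.2.2.2.2.symm.trans h5))
    by_cases hc : sig0 k₀ + (j.1 0 + j.1 1) = 2 ∧ sig1 k₀ + (j.1 2 + j.1 3) = 2 ∧ sig2 k₀ + (j.1 4 + j.1 5) = 2 ∧ sig3 k₀ + (j.1 6 + j.1 7) = 2 ∧
        sig4 k₀ + (j.1 8 + j.1 9) = 2
    · rw [if_pos ⟨by omega, by omega, by omega, by omega, by omega⟩]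
      set g : ℕ → K := fun ℓ => ζ ^ (i.1 6 + i.1 8) * Z8.eval ζ (Ψ.A (sig0 k₀) (sig1 k₀) (sig2 k₀) (i.1 0) (i.1 2) (i.1 4) ℓ) *
        (ζ ^ (j.1 6 + 1 + (j.1 8 + 1)) * Z8.eval ζ (Ψ.B (sig0 k₀) (sig1 k₀) (sig2 k₀) ℓ (j.1 0) (j.1 2) (j.1 4))) with hg
      have hterm : ∀ m : Fin r, U8 ζ Ψ modeK off i m * V8 ζ Ψ modeK off m j = if modeK m = k₀ then g (m.1 - off k₀) else 0 := by
        intro m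
        by_cases hm : modeK m = k₀
        · rw [if_pos hm, hg]
          unfold U8 V8
          rw [hm, if_pos ⟨h0, h1, h2, h3, h5⟩, if_pos hc]
        · rw [if_neg hm, hU m hm, zero_mul]
      rw [Finset.sum_congr rfl fun m _ => hterm m, sum_modes modeK off (rs8 Ψ) H1 H2 H3 k₀ g,
        ← CoreCert.factor_eq hV (s0 := sig0 k₀) (s1 := sig1 k₀) (s2 := sig2 k₀) (a := i.1 0) (b := i.1 2) (e := i.1 4)
          (a' := j.1 0) (b' := j.1 2) (e' := j.1 4) (by omega) (by omega) (by omega) (by omega) (by omega) (by omega) (by omega) (by omega)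
          (by omega), Z8.eval_rsum, Finset.mul_sum]
      exact Finset.sum_congr rfl fun ℓ _ => by
        rw [hg, Z8.eval_mul ζ h4]
        ring
    · rw [if_neg fun h => hc ⟨by omega, by omega, by omega, by omega, by omega⟩]
      symm
      refine Finset.sum_eq_zero fun m _ => ?_
      by_cases hm : modeK m = k₀
      · unfold V8
        rw [hm, if_neg hc, mul_zero]
      · rw [hU m hm, zero_mul]
  · -- a row with some pair sum > 2 (no type): both sides vanish
    have hsum := row_sum i.1 i.2
    have hU : ∀ m : Fin r, U8 ζ Ψ modeK off i m = 0 := fun m => by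
      unfold U8
      exact if_neg fun h => hex ⟨modeK m, h⟩
    rw [Finset.sum_eq_zero fun m _ => by rw [hU m, zero_mul], if_neg]
    intro hc
    obtain ⟨c0, c1, c2, c3, c4⟩ := hc
    exact hex (sig_cover' (i.1 0 + i.1 1) (i.1 2 + i.1 3) (i.1 4 + i.1 5) (i.1 6 + i.1 7) (i.1 8 + i.1 9) (by omega) (by omega) (by omega)
      (by omega) (by omega) (by omega))

/-- UPPER BOUND: rank M_δ ≤ r. -/
theorem rank_le_of_cert8 (h4 : ζ ^ 4 = -1) (hV : Ψ.valid L = true)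
    (H1 : ∀ m : Fin r, off (modeK m) ≤ m.1 ∧ m.1 < off (modeK m) + rs8 Ψ (modeK m)) (H2 : ∀ k : Fin 45, off k + rs8 Ψ k ≤ r)
    (H3 : ∀ m : Fin r, ∀ k : Fin 45, off k ≤ m.1 → m.1 < off k + rs8 Ψ k → modeK m = k) :
    (ivhsMatrix 8 4 ζ (planeList8 L)).rank ≤ r := by
  rw [ivhsMatrix_planeList8_eq_mul ζ L Ψ modeK off h4 hV H1 H2 H3]
  exact (Matrix.rank_mul_le_left _ _).trans (by simpa using Matrix.rank_le_card_width (U8 ζ Ψ modeK off))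

/-! ### the witness minor -/

/-- the row (h₀, σ₀−h₀, h₁, σ₁−h₁, h₂, σ₂−h₂, 0, σ₃, 0, σ₄) of type k with head h … -/
def mkRow8 (k : Fin 45) (h : ℕ × ℕ × ℕ) : Fin 10 → ℕ :=
  ![h.1, sig0 k - h.1, h.2.1, sig1 k - h.2.1, h.2.2, sig2 k - h.2.2, 0, sig3 k, 0, sig4 k]
/-- … and the column (g₀, 2−σ₀−g₀, …, 0, 2−σ₃, 0, 2−σ₄) of the complementary type with head g. -/
def mkCol8 (k : Fin 45) (g : ℕ × ℕ × ℕ) : Fin 10 → ℕ :=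
  ![g.1, 2 - sig0 k - g.1, g.2.1, 2 - sig1 k - g.2.1, g.2.2, 2 - sig2 k - g.2.2, 0, 2 - sig3 k, 0, 2 - sig4 k]

/-- the pivot rows lie in I_{d−2} … -/
theorem mkRow8_mem (k : Fin 45) (h : ℕ × ℕ × ℕ) (hb : h.1 ≤ sig0 k ∧ h.2.1 ≤ sig1 k ∧ h.2.2 ≤ sig2 k) :
    mkRow8 k h ∈ indexSet 8 4 (8 / 2 * 4 - 8 - 2) := by
  obtain ⟨l0, l1, l2, l3, l4⟩ := sig_le k
  have hs := sig_sum k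
  unfold indexSet
  simp only [Finset.mem_filter, Fintype.mem_piFinset, Finset.mem_range, Fin.forall_fin_succ, Fin.sum_univ_succ]
  simp [mkRow8]
  omega

/-- … and the pivot columns in I_d. -/
theorem mkCol8_mem (k : Fin 45) (g : ℕ × ℕ × ℕ) (hb : g.1 ≤ 2 - sig0 k ∧ g.2.1 ≤ 2 - sig1 k ∧ g.2.2 ≤ 2 - sig2 k) :
    mkCol8 k g ∈ indexSet 8 4 4 := by
  obtain ⟨l0, l1, l2, l3, l4⟩ := sig_le k
  have hs := sig_sum k
  unfold indexSet
  simp only [Finset.mem_filter, Fintype.mem_piFinset, Finset.mem_range, Fin.forall_fin_succ, Fin.sum_univ_succ]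
  simp [mkCol8]
  omega

/-- heads, pair sums and tail of a pivot row … -/
theorem mkRow8_val (k : Fin 45) (h : ℕ × ℕ × ℕ) (hb : h.1 ≤ sig0 k ∧ h.2.1 ≤ sig1 k ∧ h.2.2 ≤ sig2 k) :
    mkRow8 k h 0 = h.1 ∧ mkRow8 k h 2 = h.2.1 ∧ mkRow8 k h 4 = h.2.2 ∧ mkRow8 k h 6 = 0 ∧ mkRow8 k h 8 = 0 ∧
    mkRow8 k h 0 + mkRow8 k h 1 = sig0 k ∧ mkRow8 k h 2 + mkRow8 k h 3 = sig1 k ∧ mkRow8 k h 4 + mkRow8 k h 5 = sig2 k ∧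
    mkRow8 k h 6 + mkRow8 k h 7 = sig3 k ∧ mkRow8 k h 8 + mkRow8 k h 9 = sig4 k := by
  simp [mkRow8]
  omega

/-- … and of a pivot column. -/
theorem mkCol8_val (k : Fin 45) (g : ℕ × ℕ × ℕ) (hb : g.1 ≤ 2 - sig0 k ∧ g.2.1 ≤ 2 - sig1 k ∧ g.2.2 ≤ 2 - sig2 k) :
    mkCol8 k g 0 = g.1 ∧ mkCol8 k g 2 = g.2.1 ∧ mkCol8 k g 4 = g.2.2 ∧ mkCol8 k g 6 = 0 ∧ mkCol8 k g 8 = 0 ∧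
    sig0 k + (mkCol8 k g 0 + mkCol8 k g 1) = 2 ∧ sig1 k + (mkCol8 k g 2 + mkCol8 k g 3) = 2 ∧ sig2 k + (mkCol8 k g 4 + mkCol8 k g 5) = 2 ∧
    sig3 k + (mkCol8 k g 6 + mkCol8 k g 7) = 2 ∧ sig4 k + (mkCol8 k g 8 + mkCol8 k g 9) = 2 := by
  obtain ⟨l0, l1, l2, l3, l4⟩ := sig_le k
  simp [mkCol8]
  omega

variable {L Ψ modeK off}

/-- ℓ(m) < r_{shape(m)}. -/
theorem modeL_lt8 (H1 : ∀ m : Fin r, off (modeK m) ≤ m.1 ∧ m.1 < off (modeK m) + rs8 Ψ (modeK m)) (m : Fin r) :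
    m.1 - off (modeK m) < rs8 Ψ (modeK m) := by
  have := H1 m
  omega

/-- the box facts of the pivots of mode m. -/
theorem pivot_box8 (hV : Ψ.valid L = true) (H1 : ∀ m : Fin r, off (modeK m) ≤ m.1 ∧ m.1 < off (modeK m) + rs8 Ψ (modeK m)) (m : Fin r) :
    ((Ψ.rowP (sig0 (modeK m)) (sig1 (modeK m)) (sig2 (modeK m)) (m.1 - off (modeK m))).1 ≤ sig0 (modeK m) ∧
      (Ψ.rowP (sig0 (modeK m)) (sig1 (modeK m)) (sig2 (modeK m)) (m.1 - off (modeK m))).2.1 ≤ sig1 (modeK m) ∧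
      (Ψ.rowP (sig0 (modeK m)) (sig1 (modeK m)) (sig2 (modeK m)) (m.1 - off (modeK m))).2.2 ≤ sig2 (modeK m)) ∧
    ((Ψ.colP (sig0 (modeK m)) (sig1 (modeK m)) (sig2 (modeK m)) (m.1 - off (modeK m))).1 ≤ 2 - sig0 (modeK m) ∧
      (Ψ.colP (sig0 (modeK m)) (sig1 (modeK m)) (sig2 (modeK m)) (m.1 - off (modeK m))).2.1 ≤ 2 - sig1 (modeK m) ∧
      (Ψ.colP (sig0 (modeK m)) (sig1 (modeK m)) (sig2 (modeK m)) (m.1 - off (modeK m))).2.2 ≤ 2 - sig2 (modeK m)) := by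
  obtain ⟨l0, l1, l2, l3, l4⟩ := sig_le (modeK m)
  obtain ⟨-, -, hb⟩ := CoreCert.pivots hV (by omega) (by omega) (by omega) (modeL_lt8 H1 m)
  exact ⟨⟨hb.1, hb.2.1, hb.2.2.1⟩, hb.2.2.2⟩

/-- the pivot row of mode m … -/
def rho8 (hV : Ψ.valid L = true) (H1 : ∀ m : Fin r, off (modeK m) ≤ m.1 ∧ m.1 < off (modeK m) + rs8 Ψ (modeK m)) (m : Fin r) :
    indexSet 8 4 (8 / 2 * 4 - 8 - 2) :=
  ⟨mkRow8 (modeK m) (Ψ.rowP (sig0 (modeK m)) (sig1 (modeK m)) (sig2 (modeK m)) (m.1 - off (modeK m))), mkRow8_mem _ _ (pivot_box8 hV H1 m).1⟩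

/-- … and its pivot column. -/
def gam8 (hV : Ψ.valid L = true) (H1 : ∀ m : Fin r, off (modeK m) ≤ m.1 ∧ m.1 < off (modeK m) + rs8 Ψ (modeK m)) (m : Fin r) :
    indexSet 8 4 4 :=
  ⟨mkCol8 (modeK m) (Ψ.colP (sig0 (modeK m)) (sig1 (modeK m)) (sig2 (modeK m)) (m.1 - off (modeK m))), mkCol8_mem _ _ (pivot_box8 hV H1 m).2⟩

/-- heads, pair sums and tail of ρ(m) … -/
theorem rho8_val (hV : Ψ.valid L = true) (H1 : ∀ m : Fin r, off (modeK m) ≤ m.1 ∧ m.1 < off (modeK m) + rs8 Ψ (modeK m)) (m : Fin r) :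
    (rho8 hV H1 m).1 0 = (Ψ.rowP (sig0 (modeK m)) (sig1 (modeK m)) (sig2 (modeK m)) (m.1 - off (modeK m))).1 ∧
    (rho8 hV H1 m).1 2 = (Ψ.rowP (sig0 (modeK m)) (sig1 (modeK m)) (sig2 (modeK m)) (m.1 - off (modeK m))).2.1 ∧
    (rho8 hV H1 m).1 4 = (Ψ.rowP (sig0 (modeK m)) (sig1 (modeK m)) (sig2 (modeK m)) (m.1 - off (modeK m))).2.2 ∧
    (rho8 hV H1 m).1 6 = 0 ∧ (rho8 hV H1 m).1 8 = 0 ∧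
    (rho8 hV H1 m).1 0 + (rho8 hV H1 m).1 1 = sig0 (modeK m) ∧ (rho8 hV H1 m).1 2 + (rho8 hV H1 m).1 3 = sig1 (modeK m) ∧
    (rho8 hV H1 m).1 4 + (rho8 hV H1 m).1 5 = sig2 (modeK m) ∧ (rho8 hV H1 m).1 6 + (rho8 hV H1 m).1 7 = sig3 (modeK m) ∧
    (rho8 hV H1 m).1 8 + (rho8 hV H1 m).1 9 = sig4 (modeK m) :=
  mkRow8_val (modeK m) _ (pivot_box8 hV H1 m).1

/-- … and of γ(m). -/
theorem gam8_val (hV : Ψ.valid L = true) (H1 : ∀ m : Fin r, off (modeK m) ≤ m.1 ∧ m.1 < off (modeK m) + rs8 Ψ (modeK m)) (m : Fin r) :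
    (gam8 hV H1 m).1 0 = (Ψ.colP (sig0 (modeK m)) (sig1 (modeK m)) (sig2 (modeK m)) (m.1 - off (modeK m))).1 ∧
    (gam8 hV H1 m).1 2 = (Ψ.colP (sig0 (modeK m)) (sig1 (modeK m)) (sig2 (modeK m)) (m.1 - off (modeK m))).2.1 ∧
    (gam8 hV H1 m).1 4 = (Ψ.colP (sig0 (modeK m)) (sig1 (modeK m)) (sig2 (modeK m)) (m.1 - off (modeK m))).2.2 ∧
    (gam8 hV H1 m).1 6 = 0 ∧ (gam8 hV H1 m).1 8 = 0 ∧
    sig0 (modeK m) + ((gam8 hV H1 m).1 0 + (gam8 hV H1 m).1 1) = 2 ∧ sig1 (modeK m) + ((gam8 hV H1 m).1 2 + (gam8 hV H1 m).1 3) = 2 ∧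
    sig2 (modeK m) + ((gam8 hV H1 m).1 4 + (gam8 hV H1 m).1 5) = 2 ∧ sig3 (modeK m) + ((gam8 hV H1 m).1 6 + (gam8 hV H1 m).1 7) = 2 ∧
    sig4 (modeK m) + ((gam8 hV H1 m).1 8 + (gam8 hV H1 m).1 9) = 2 :=
  mkCol8_val (modeK m) _ (pivot_box8 hV H1 m).2

/-- U on a pivot row: supported on the modes of the same type, with value ζ⁰⁺⁰ · A_σ[h_{ℓ(m)}, ℓ(m')]. -/
theorem U8_rho (hV : Ψ.valid L = true) (H1 : ∀ m : Fin r, off (modeK m) ≤ m.1 ∧ m.1 < off (modeK m) + rs8 Ψ (modeK m)) (m m' : Fin r) :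
    U8 ζ Ψ modeK off (rho8 hV H1 m) m' = if modeK m' = modeK m then
      ζ ^ (0 + 0) * Z8.eval ζ (Ψ.A (sig0 (modeK m)) (sig1 (modeK m)) (sig2 (modeK m))
        (Ψ.rowP (sig0 (modeK m)) (sig1 (modeK m)) (sig2 (modeK m)) (m.1 - off (modeK m))).1
        (Ψ.rowP (sig0 (modeK m)) (sig1 (modeK m)) (sig2 (modeK m)) (m.1 - off (modeK m))).2.1
        (Ψ.rowP (sig0 (modeK m)) (sig1 (modeK m)) (sig2 (modeK m)) (m.1 - off (modeK m))).2.2 (m'.1 - off (modeK m))) else 0 := by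
  obtain ⟨e0, e2, e4, e6, e8, p0, p1, p2, p3, p4⟩ := rho8_val hV H1 m
  unfold U8
  rw [p0, p1, p2, p3, p4, e0, e2, e4, e6, e8]
  by_cases hk : modeK m' = modeK m
  · rw [if_pos hk, hk, if_pos ⟨rfl, rfl, rfl, rfl, rfl⟩]
  · rw [if_neg hk, if_neg]
    intro h
    exact hk (sig_inj _ _ h.1.symm h.2.1.symm h.2.2.1.symm h.2.2.2.1.symm h.2.2.2.2.symm)

/-- V on a pivot column: supported on the modes of the same type, with value ζ² · B_σ[ℓ(m), g_{ℓ(m')}]. -/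
theorem V8_gam (hV : Ψ.valid L = true) (H1 : ∀ m : Fin r, off (modeK m) ≤ m.1 ∧ m.1 < off (modeK m) + rs8 Ψ (modeK m)) (m m' : Fin r) :
    V8 ζ Ψ modeK off m (gam8 hV H1 m') = if modeK m = modeK m' then
      ζ ^ (0 + 1 + (0 + 1)) * Z8.eval ζ (Ψ.B (sig0 (modeK m')) (sig1 (modeK m')) (sig2 (modeK m')) (m.1 - off (modeK m'))
        (Ψ.colP (sig0 (modeK m')) (sig1 (modeK m')) (sig2 (modeK m')) (m'.1 - off (modeK m'))).1
        (Ψ.colP (sig0 (modeK m')) (sig1 (modeK m')) (sig2 (modeK m')) (m'.1 - off (modeK m'))).2.1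
        (Ψ.colP (sig0 (modeK m')) (sig1 (modeK m')) (sig2 (modeK m')) (m'.1 - off (modeK m'))).2.2) else 0 := by
  obtain ⟨e0, e2, e4, e6, e8, p0, p1, p2, p3, p4⟩ := gam8_val hV H1 m'
  unfold V8
  by_cases hk : modeK m = modeK m'
  · rw [if_pos hk, hk, p0, p1, p2, p3, p4, e0, e2, e4, e6, e8, if_pos ⟨rfl, rfl, rfl, rfl, rfl⟩]
  · rw [if_neg hk, if_neg]
    intro h
    exact hk (sig_inj _ _ (by omega) (by omega) (by omega) (by omega) (by omega))

/-- LOWER BOUND: rank M_δ ≥ r. -/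
theorem le_rank_of_cert8 [CharZero K] (h4 : ζ ^ 4 = -1) (hV : Ψ.valid L = true)
    (H1 : ∀ m : Fin r, off (modeK m) ≤ m.1 ∧ m.1 < off (modeK m) + rs8 Ψ (modeK m)) (H2 : ∀ k : Fin 45, off k + rs8 Ψ k ≤ r)
    (H3 : ∀ m : Fin r, ∀ k : Fin 45, off k ≤ m.1 → m.1 < off k + rs8 Ψ k → modeK m = k) :
    r ≤ (ivhsMatrix 8 4 ζ (planeList8 L)).rank := by
  classical
  have hz : ζ ≠ 0 := by
    rintro rfl
    norm_num at h4
  set M := ivhsMatrix 8 4 ζ (planeList8 L) with hM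
  have hS : M.submatrix (rho8 hV H1) (gam8 hV H1) = (U8 ζ Ψ modeK off).submatrix (rho8 hV H1) id * (V8 ζ Ψ modeK off).submatrix id (gam8 hV H1) := by
    rw [hM, ivhsMatrix_planeList8_eq_mul ζ L Ψ modeK off h4 hV H1 H2 H3]
    exact Matrix.submatrix_mul _ _ _ _ _ Function.bijective_id
  -- the left factor of the minor is lower triangular with nonzero diagonal
  have hUt : ((U8 ζ Ψ modeK off).submatrix (rho8 hV H1) id).BlockTriangular OrderDual.toDual := by
    intro m m' hlt
    have hlt' : m < m' := OrderDual.toDual_lt_toDual.mp hlt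
    rw [Matrix.submatrix_apply, id_eq, U8_rho ζ hV H1]
    by_cases hk : modeK m' = modeK m
    · rw [if_pos hk]
      obtain ⟨l0, l1, l2, l3, l4⟩ := sig_le (modeK m)
      obtain ⟨hℓ, hℓ'⟩ := modeL_lt_of_lt modeK off (rs8 Ψ) H1 hlt' hk
      rw [CoreCert.A_upper_zero hV (by omega) (by omega) (by omega) (modeL_lt8 H1 m) hℓ' hℓ, Z8.zero_def, Z8.eval_zero, mul_zero]
    · rw [if_neg hk]
  have hUd : ∀ m : Fin r, ((U8 ζ Ψ modeK off).submatrix (rho8 hV H1) id) m m ≠ 0 := by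
    intro m
    rw [Matrix.submatrix_apply, id_eq, U8_rho ζ hV H1, if_pos rfl, add_zero, pow_zero, one_mul]
    obtain ⟨l0, l1, l2, l3, l4⟩ := sig_le (modeK m)
    exact Z8.eval_ne_zero_of_posConst ζ (CoreCert.pivots hV (by omega) (by omega) (by omega) (modeL_lt8 H1 m)).1
  -- the right factor of the minor is upper triangular with nonzero diagonal
  have hVt : ((V8 ζ Ψ modeK off).submatrix id (gam8 hV H1)).BlockTriangular id := by
    intro m m' hlt
    have hlt' : m' < m := hlt
    rw [Matrix.submatrix_apply, id_eq, V8_gam ζ hV H1]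
    by_cases hk : modeK m = modeK m'
    · rw [if_pos hk]
      obtain ⟨l0, l1, l2, l3, l4⟩ := sig_le (modeK m')
      obtain ⟨hℓ, hℓ'⟩ := modeL_lt_of_lt modeK off (rs8 Ψ) H1 hlt' hk
      rw [CoreCert.B_lower_zero hV (by omega) (by omega) (by omega) (modeL_lt8 H1 m') hℓ' hℓ, Z8.zero_def, Z8.eval_zero, mul_zero]
    · rw [if_neg hk]
  have hVd : ∀ m : Fin r, ((V8 ζ Ψ modeK off).submatrix id (gam8 hV H1)) m m ≠ 0 := by
    intro m
    rw [Matrix.submatrix_apply, id_eq, V8_gam ζ hV H1, if_pos rfl]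
    obtain ⟨l0, l1, l2, l3, l4⟩ := sig_le (modeK m)
    have hBw := Z8.eval_ne_zero_of_posConst ζ (CoreCert.pivots hV (by omega) (by omega) (by omega) (modeL_lt8 H1 m)).2.1
    rw [Z8.eval_mul ζ h4] at hBw
    exact mul_ne_zero (pow_ne_zero _ hz) (left_ne_zero_of_mul hBw)
  have hdet : IsUnit (M.submatrix (rho8 hV H1) (gam8 hV H1)).det := by
    rw [hS, Matrix.det_mul, Matrix.det_of_lowerTriangular _ hUt, Matrix.det_of_upperTriangular hVt]
    exact isUnit_iff_ne_zero.mpr (mul_ne_zero (Finset.prod_ne_zero_iff.mpr fun m _ => hUd m)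
      (Finset.prod_ne_zero_iff.mpr fun m _ => hVd m))
  have hrank : (M.submatrix (rho8 hV H1) (gam8 hV H1)).rank = r := by
    rw [Matrix.rank_of_isUnit _ ((Matrix.isUnit_iff_isUnit_det _).mpr hdet), Fintype.card_fin]
  calc r = (M.submatrix (rho8 hV H1) (gam8 hV H1)).rank := hrank.symm
    _ ≤ M.rank := Matrix.rank_submatrix_le M _ _

/-- MAIN THEOREM (n = 8): a valid core certificate with a mode enumeration decides the row `IvhsRankEq 8 4 r (planeList8 L)`. -/
theorem ivhsRankEq_of_cert8 (L : List (ℤ × ℕ × ℕ × ℕ)) (Ψ : CoreCert) (hV : Ψ.valid L = true) {r : ℕ} (modeK : Fin r → Fin 45)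
    (off : Fin 45 → ℕ) (H1 : ∀ m : Fin r, off (modeK m) ≤ m.1 ∧ m.1 < off (modeK m) + rs8 Ψ (modeK m))
    (H2 : ∀ k : Fin 45, off k + rs8 Ψ k ≤ r) (H3 : ∀ m : Fin r, ∀ k : Fin 45, off k ≤ m.1 → m.1 < off k + rs8 Ψ k → modeK m = k) :
    IvhsRankEq 8 4 r (planeList8 L) := by
  intro K _ _ ζ hζ
  have h4 : ζ ^ 4 = -1 := zeta_pow_four_of_primitive hζ
  exact le_antisymm (rank_le_of_cert8 ζ L Ψ modeK off h4 hV H1 H2 H3) (le_rank_of_cert8 ζ h4 hV H1 H2 H3)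

end cert

end Summit.HodgeConjecture.HodgeConjecture.HodgeLocus.Census.PlaneSum
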